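import Mathlib
import Summits.NavierStokesRegularity.NavierStokesRegularity.Theorems.EulerZoomLiouvillePowerGaugeEulerLiouvilleEnergySaturationLoc
import HarnessLib

/-!
# Energy saturation on the crux `EulerZoomLiouville.PowerGaugeEulerLiouville` — NEGATIVE RATES, tools: the scale ODE at an arbitrary rate
# `g ≠ 0` and the floor-free bootstrap at a negative rate `g < 0`
# (crux = stmt-NavierStokesRegularity-19832, route №10 `EulerZoomLiouville`; line `logtime-breathers`, residue T4 `stub_powerClockRest`)

Extra-width seat `ns-ezl-w7` (cell ns-regularity-ideate, LEAD ns-typeII-p2 g11).  Tools of the PROFILE-LEVEL lever behind «WEAK NEGATIVE-RATE power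
clocks `g < 0` about any `(T, x₀)` on a past sub-slab are trivial» (sequels `…EnergySaturationNegRate`, `…SelfSimilarNegClockPast`): the `g < 0`
complement of width seat ns-ezl-w6's slow-rate bootstrap (`EnergySaturation.slowRate_step` / `slowRate_iterate`, `0 < g < 2/5`, file
`…EnergySaturationSlowRate`, whose proof architecture this file follows — `-- adapted from` markers below).  The cut-off energy is
`J(L) = ∫σ(L⁻¹y)|V|²`, the flux `F(L) = ∫(|V|²+2P)⟪V,∇σ_L⟫`.

* `hasDerivAt_rpow_mul_cutoffEnergy_of_energyEquality_rate` — the SCALE ODE at any rate `g ≠ 0`: if the profile local energy EQUALITY of a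
  rate-`g` collapse holds for `σ_L`, `(2 − 5g)∫σ_L|V|² = ∫(|V|²+2P)⟪V,∇σ_L⟫ + g∫|V|²⟪y,∇σ_L⟫`, then `(L^κ J)'(L) = g⁻¹ L^{κ−1} F(L)` with
  `κ = (2 − 5g)/g` (ns-ezl-w1's `hasDerivAt_normEnergy_of_energyEquality` is the case `g = 1/(2+ρ)`, `κ = 2ρ − 1`).
* `negRate_step` — BOOTSTRAP STEP at `g < 0` (pure real analysis): `J ≤ C R^m` on `[L₁,∞)` (`m ≤ 1−2ρ`, admissible tail suprema)
  ⇒ `J ≤ C' R^{m/2 − 5ρ/4}` with NO FLOOR: the flux bound through the tail supremum gives `|F| ≤ B r^{μ}`, `μ = m/2 − 5ρ/4`; since `κ < −5`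
  the class bound kills the boundary term AT INFINITY, `R^κ J(R) → 0`, and `Ψ(R) = R^κ J(R) − (B/(|g|ν)) R^{κ+μ}` (`ν = −(κ+μ) > 0`) is
  non-decreasing with limit `0`, hence `≤ 0`, i.e. `J(R) ≤ (B/(|g|ν)) R^{μ}`.
* `negRate_iterate` — from `m₀ = 1−2ρ` finitely many steps reach `m < 0` (each step loses `≥ 5ρ/4`).

In words: at a negative rate the own-rate homogeneous solution `R^{−κ} = R^{5 + 2/|g|}` GROWS faster than the class allows, so ball energy is fed by
the flux alone, which is sub-linear (`∝ S^{1/2}`) in the energy.  WHAT THIS IS NOT: not NS regularity, not the crux — lemmas for one stratum of the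
crux CLASS 19832 on the MODEL lattice (`--supports` stmt-19832). [folklore; cf. BronziShvydkoy2015 Thm 1.1, ChaeShvydkoy2013 §2.2 (2.12)]
-/

noncomputable section

-- flat `Theorems/<Route><Decl>…` files of one crux share the namespace of the crux (tree convention: `Summit.<S>.<S>.…`)
set_option linter.dupNamespace false

open MeasureTheory Set Filter Topology Metric Function TopologicalSpace
open scoped ENNReal NNReal RealInnerProductSpace ContDiff Laplacian

namespace Summit.NavierStokesRegularity.NavierStokesRegularity.Theorems.PowerGaugeEulerLiouville

open Literature.Analysis Literature.Analysis.FunctionSpaces Literature.Analysis.FluidPDE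

namespace EnergySaturation

/-! ## The scale ODE at an arbitrary non-zero rate -/

section ScaleODE

variable {g : ℝ} {σ : EuclideanSpace ℝ (Fin 3) → ℝ}
  {V : EuclideanSpace ℝ (Fin 3) → EuclideanSpace ℝ (Fin 3)} {P : EuclideanSpace ℝ (Fin 3) → ℝ}

/-- **The scale ODE for the cut-off energy at rate `g ≠ 0`.**  Let `σ` be a test function, `V ∈ L²_loc`, and suppose the profile local energy
EQUALITY of a rate-`g` self-similar collapse holds for the rescaled cut-off `σ_L = σ(L⁻¹·)`:
`(2 − 5g)∫σ_L|V|² = ∫(|V|²+2P)⟪V,∇σ_L⟫ + g∫|V|²⟪y,∇σ_L⟫`.  Then `J(L) = ∫σ(L⁻¹y)|V|²` satisfies, at this `L > 0`,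
`(L^κ J)'(L) = g⁻¹ L^{κ−1} F_σ(L)`, `κ = (2−5g)/g`, `F_σ(L) = ∫(|V|²+2P)⟪V,∇σ_L⟫` (since `g⟪y,∇σ_L(y)⟫|V|²` integrates to `−gL·J'(L)`).
[folklore; cf. ChaeShvydkoy2013 §2.2 (2.12)] -/
theorem hasDerivAt_rpow_mul_cutoffEnergy_of_energyEquality_rate (hg : g ≠ 0)
    (hσ : IsTestFunctionOn (⊤ : Opens (EuclideanSpace ℝ (Fin 3))) σ)
    (hVm : AEStronglyMeasurable V volume)
    (hV2 : LocallyIntegrable (fun y => ‖V y‖ ^ 2) volume)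
    {L : ℝ} (hL : 0 < L)
    (hEE : (2 - 5 * g) * ∫ x, σ (L⁻¹ • x) * ‖V x‖ ^ 2 =
      (∫ x, (‖V x‖ ^ 2 + 2 * P x) * ⟪V x, gradient (fun z => σ (L⁻¹ • z)) x⟫) +
        g * ∫ x, ‖V x‖ ^ 2 * ⟪x, gradient (fun z => σ (L⁻¹ • z)) x⟫) :
    HasDerivAt (fun L : ℝ => L ^ ((2 - 5 * g) / g) * ∫ y, σ (L⁻¹ • y) * ‖V y‖ ^ 2)
      (g⁻¹ * L ^ ((2 - 5 * g) / g - 1) *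
        ∫ x, (‖V x‖ ^ 2 + 2 * P x) * ⟪V x, gradient (fun z => σ (L⁻¹ • z)) x⟫) L := by
  -- adapted from `hasDerivAt_normEnergy_of_energyEquality` (…EnergySaturationIdentity, ns-ezl-w1)
  set κ : ℝ := (2 - 5 * g) / g with hκ
  have hσ1 : ContDiff ℝ 1 σ := hσ.contDiff.of_le (by norm_cast)
  have hσd : Differentiable ℝ σ := hσ1.differentiable one_ne_zero
  obtain ⟨-, hI⟩ := hasDerivAt_cutoffEnergy hσ1 hσ.hasCompactSupport hVm hV2 hL
  -- the derivative of the product `L^κ · I(L)`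
  have hpow : HasDerivAt (fun L : ℝ => L ^ κ) (κ * L ^ (κ - 1)) L :=
    Real.hasDerivAt_rpow_const (Or.inl hL.ne')
  have hprod : HasDerivAt (fun L : ℝ => L ^ κ * ∫ y, σ (L⁻¹ • y) * ‖V y‖ ^ 2)
      (κ * L ^ (κ - 1) * (∫ y, σ (L⁻¹ • y) * ‖V y‖ ^ 2) +
        L ^ κ * ∫ y, (-(L ^ 2)⁻¹ * fderiv ℝ σ (L⁻¹ • y) y) * ‖V y‖ ^ 2) L :=
    hpow.mul hI
  refine hprod.congr_deriv ?_
  -- rewrite the Euler term of (EE) through the scale derivative of the cut-off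
  have heuler : ∫ x, ‖V x‖ ^ 2 * ⟪x, gradient (fun z => σ (L⁻¹ • z)) x⟫ =
      -L * ∫ y, (-(L ^ 2)⁻¹ * fderiv ℝ σ (L⁻¹ • y) y) * ‖V y‖ ^ 2 := by
    rw [← integral_const_mul]
    refine integral_congr_ae (Eventually.of_forall fun y => ?_)
    show ‖V y‖ ^ 2 * ⟪y, gradient (fun z => σ (L⁻¹ • z)) y⟫ =
      -L * (-(L ^ 2)⁻¹ * fderiv ℝ σ (L⁻¹ • y) y * ‖V y‖ ^ 2)
    rw [inner_self_gradient_comp_inv_smul hσd, map_smul, smul_eq_mul]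
    field_simp
  -- solve (EE) for the flux and substitute
  have hflux : (∫ x, (‖V x‖ ^ 2 + 2 * P x) * ⟪V x, gradient (fun z => σ (L⁻¹ • z)) x⟫) =
      (2 - 5 * g) * (∫ x, σ (L⁻¹ • x) * ‖V x‖ ^ 2) -
        g * (-L * ∫ y, (-(L ^ 2)⁻¹ * fderiv ℝ σ (L⁻¹ • y) y) * ‖V y‖ ^ 2) := by
    rw [← heuler]; linarith
  rw [hflux]
  have e2 : L ^ κ = L ^ (κ - 1) * L := by
    conv_lhs => rw [show κ = (κ - 1) + 1 by ring, Real.rpow_add hL, Real.rpow_one]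
  rw [e2]
  have hκg : κ * g = 2 - 5 * g := by rw [hκ]; field_simp
  rw [← hκg]
  field_simp
  ring

end ScaleODE

/-! ## The bootstrap at a negative rate -/

section Bootstrap

variable {ρ g : ℝ} {c : ℝ≥0} {A : ℝ} {J F : ℝ → ℝ}

/-- **THE BOOTSTRAP STEP AT A NEGATIVE RATE** (pure real analysis).  `J ≥ 0`; the flux bound through the tail supremum with data exponent `ρ`
(conclusion of `exists_fluxWeight_le_of_sup_loc`); the scale ODE `(R^κ J)'(r) = g⁻¹ r^{κ−1} F(r)`, `κ = (2−5g)/g`, with `g < 0`.  If `J(R) ≤ C R^m`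
on `[L₁,∞)` (`m ≤ 1−2ρ`, `L₁ ≥ 1`) with admissible tail suprema `C r^{m−(1−2ρ)} ≤ 3c`, then `J(R) ≤ C' R^{m/2 − 5ρ/4}` on `[L₁,∞)` — no floor:
`κ < −5`, so the boundary term at infinity dies and `Ψ(R) = R^κJ(R) − (B/(|g|ν))R^{κ+μ}` (`μ = m/2 − 5ρ/4`, `ν = −(κ+μ)`) is non-decreasing with
limit `0`. [folklore] -/
theorem negRate_step (hρ : 0 < ρ) (hg : g < 0) (hA0 : 0 ≤ A)
    (hJ0 : ∀ R : ℝ, 0 < R → 0 ≤ J R)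
    (hflux : ∀ S : ℝ, 0 ≤ S → S ≤ 3 * c → ∀ L : ℝ, 1 ≤ L →
      (∀ R : ℝ, L ≤ R → J R ≤ R ^ (1 - 2 * ρ) * S) →
      ∀ r : ℝ, L ≤ r → |(2 + ρ) * r ^ (2 * ρ - 2) * F r| ≤ A * S ^ (1 / 2 : ℝ) * r ^ (-1 - (2 + ρ) / 4))
    (hderiv : ∀ r : ℝ, 0 < r →
      HasDerivAt (fun L : ℝ => L ^ ((2 - 5 * g) / g) * J L) (g⁻¹ * r ^ ((2 - 5 * g) / g - 1) * F r) r)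
    {m C L₁ : ℝ} (hm : m ≤ 1 - 2 * ρ) (hC : 0 ≤ C) (hL₁ : 1 ≤ L₁)
    (hbound : ∀ R : ℝ, L₁ ≤ R → J R ≤ C * R ^ m)
    (h3c : ∀ r : ℝ, L₁ ≤ r → C * r ^ (m - (1 - 2 * ρ)) ≤ 3 * c) :
    ∃ C' : ℝ, 0 ≤ C' ∧ ∀ R : ℝ, L₁ ≤ R → J R ≤ C' * R ^ (m / 2 - 5 * ρ / 4) := by
  -- adapted from `slowRate_step` (…EnergySaturationSlowRate, ns-ezl-w6): part (1) verbatim, parts (2)–(3) with the boundary term at infinity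
  have h2ρ : 0 < 2 + ρ := by linarith
  have hL₁0 : 0 < L₁ := lt_of_lt_of_le one_pos hL₁
  set κ : ℝ := (2 - 5 * g) / g with hκ
  have hκ5 : κ < -5 := by
    rw [hκ, div_lt_iff_of_neg hg]; nlinarith
  set μ : ℝ := m / 2 - 5 * ρ / 4 with hμ
  have hμle : μ < 1 / 2 := by rw [hμ]; nlinarith
  set ν : ℝ := -(κ + μ) with hν
  have hν0 : 0 < ν := by rw [hν]; linarith
  set B : ℝ := A * C ^ (1 / 2 : ℝ) / (2 + ρ) with hB
  have hB0 : 0 ≤ B := by rw [hB]; positivity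
  -- ### (1) the pointwise flux bound `|F r| ≤ B r^μ` on `[L₁, ∞)`
  have hFle : ∀ r : ℝ, L₁ ≤ r → |F r| ≤ B * r ^ μ := by
    intro r hr
    have hr1 : 1 ≤ r := hL₁.trans hr
    have hr0 : 0 < r := lt_of_lt_of_le one_pos hr1
    set S : ℝ := C * r ^ (m - (1 - 2 * ρ)) with hS
    have hS0 : 0 ≤ S := by rw [hS]; exact mul_nonneg hC (Real.rpow_nonneg hr0.le _)
    have hS3 : S ≤ 3 * c := h3c r hr
    have htail : ∀ R : ℝ, r ≤ R → J R ≤ R ^ (1 - 2 * ρ) * S := by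
      intro R hR
      have hR0 : 0 < R := lt_of_lt_of_le hr0 hR
      have hRr : R ^ (m - (1 - 2 * ρ)) ≤ r ^ (m - (1 - 2 * ρ)) :=
        Real.rpow_le_rpow_of_nonpos hr0 hR (by linarith)
      have hsplit : C * R ^ m = R ^ (1 - 2 * ρ) * (C * R ^ (m - (1 - 2 * ρ))) := by
        have : R ^ m = R ^ (1 - 2 * ρ) * R ^ (m - (1 - 2 * ρ)) := by
          rw [← Real.rpow_add hR0]; ring_nf
        rw [this]; ring
      calc J R ≤ C * R ^ m := hbound R (hr.trans hR)
        _ = R ^ (1 - 2 * ρ) * (C * R ^ (m - (1 - 2 * ρ))) := hsplit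
        _ ≤ R ^ (1 - 2 * ρ) * S := by
            rw [hS]
            exact mul_le_mul_of_nonneg_left (mul_le_mul_of_nonneg_left hRr hC) (Real.rpow_nonneg hR0.le _)
    have hfl := hflux S hS0 hS3 r hr1 htail r le_rfl
    have hw0 : 0 < (2 + ρ) * r ^ (2 * ρ - 2) := mul_pos h2ρ (Real.rpow_pos_of_pos hr0 _)
    rw [abs_mul, abs_of_pos hw0] at hfl
    have hS12 : S ^ (1 / 2 : ℝ) = C ^ (1 / 2 : ℝ) * r ^ ((m - (1 - 2 * ρ)) / 2) := by
      rw [hS, Real.mul_rpow hC (Real.rpow_nonneg hr0.le _), ← Real.rpow_mul hr0.le]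
      congr 1; ring_nf
    have hkey : |F r| ≤ (A * S ^ (1 / 2 : ℝ) * r ^ (-1 - (2 + ρ) / 4)) / ((2 + ρ) * r ^ (2 * ρ - 2)) := by
      rw [le_div_iff₀ hw0]
      calc |F r| * ((2 + ρ) * r ^ (2 * ρ - 2)) = (2 + ρ) * r ^ (2 * ρ - 2) * |F r| := by ring
        _ ≤ A * S ^ (1 / 2 : ℝ) * r ^ (-1 - (2 + ρ) / 4) := hfl
    refine hkey.trans (le_of_eq ?_)
    rw [hS12, hB, div_eq_iff hw0.ne']
    have hpow : r ^ ((m - (1 - 2 * ρ)) / 2) * r ^ (-1 - (2 + ρ) / 4) = r ^ μ * r ^ (2 * ρ - 2) := by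
      rw [← Real.rpow_add hr0, ← Real.rpow_add hr0, hμ]
      congr 1; ring
    calc A * (C ^ (1 / 2 : ℝ) * r ^ ((m - (1 - 2 * ρ)) / 2)) * r ^ (-1 - (2 + ρ) / 4)
        = A * C ^ (1 / 2 : ℝ) * (r ^ ((m - (1 - 2 * ρ)) / 2) * r ^ (-1 - (2 + ρ) / 4)) := by ring
      _ = A * C ^ (1 / 2 : ℝ) * (r ^ μ * r ^ (2 * ρ - 2)) := by rw [hpow]
      _ = A * C ^ (1 / 2 : ℝ) / (2 + ρ) * r ^ μ * ((2 + ρ) * r ^ (2 * ρ - 2)) := by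
          field_simp
  -- ### (2) comparison: `Ψ(R) = R^κ J(R) − (B/((−g)ν)) R^{κ+μ}` is non-decreasing on `[L₁, ∞)`
  set E : ℝ := B / ((-g) * ν) with hE
  have hg' : 0 < -g := neg_pos.2 hg
  have hE0 : 0 ≤ E := by rw [hE]; positivity
  set Ψ : ℝ → ℝ := fun R => R ^ κ * J R - E * R ^ (κ + μ) with hΨ
  have hΨderiv : ∀ r : ℝ, L₁ ≤ r →
      HasDerivAt Ψ (g⁻¹ * r ^ (κ - 1) * F r - E * ((κ + μ) * r ^ (κ + μ - 1))) r := by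
    intro r hr
    have hr0 : 0 < r := lt_of_lt_of_le hL₁0 hr
    have h1 : HasDerivAt (fun L : ℝ => L ^ κ * J L) (g⁻¹ * r ^ (κ - 1) * F r) r := by
      have := hderiv r hr0
      rw [hκ]; exact this
    have h2 : HasDerivAt (fun L : ℝ => E * L ^ (κ + μ)) (E * ((κ + μ) * r ^ (κ + μ - 1))) r :=
      (Real.hasDerivAt_rpow_const (x := r) (p := κ + μ) (Or.inl hr0.ne')).const_mul E
    have h := h1.sub h2
    simp only [hΨ]
    convert h using 1 <;> rfl
  have hΨ'ge : ∀ r : ℝ, L₁ ≤ r →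
      0 ≤ g⁻¹ * r ^ (κ - 1) * F r - E * ((κ + μ) * r ^ (κ + μ - 1)) := by
    intro r hr
    have hr1 : 1 ≤ r := hL₁.trans hr
    have hr0 : 0 < r := lt_of_lt_of_le one_pos hr1
    have hF := hFle r hr
    have hrκ : 0 < r ^ (κ - 1) := Real.rpow_pos_of_pos hr0 _
    -- `g⁻¹ r^{κ−1} F ≥ −(−g)⁻¹ r^{κ−1} B r^μ`
    have h1 : -((-g)⁻¹ * r ^ (κ - 1) * (B * r ^ μ)) ≤ g⁻¹ * r ^ (κ - 1) * F r := by
      have hFge : -(B * r ^ μ) ≤ F r := (neg_le.2 ((neg_le_abs _).trans hF))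
      have hgi : g⁻¹ = -(-g)⁻¹ := by rw [neg_inv, neg_neg]
      rw [hgi]
      have hw : 0 < (-g)⁻¹ * r ^ (κ - 1) := mul_pos (inv_pos.2 hg') hrκ
      have hFle' : F r ≤ B * r ^ μ := (le_abs_self _).trans hF
      nlinarith
    -- the comparison term equals `(−g)⁻¹ B r^{κ+μ−1}`
    have h2 : -(E * ((κ + μ) * r ^ (κ + μ - 1))) = (-g)⁻¹ * r ^ (κ - 1) * (B * r ^ μ) := by
      have hsplit : r ^ (κ + μ - 1) = r ^ (κ - 1) * r ^ μ := by
        rw [← Real.rpow_add hr0]; ring_nf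
      rw [hsplit, hE, show κ + μ = -ν by rw [hν]; ring]
      field_simp
    linarith
  have hΨmono : MonotoneOn Ψ (Ici L₁) := by
    have hcont : ContinuousOn Ψ (Ici L₁) := fun r hr =>
      (hΨderiv r (mem_Ici.1 hr)).continuousAt.continuousWithinAt
    have hdiff : DifferentiableOn ℝ Ψ (interior (Ici L₁)) := by
      rw [interior_Ici]
      exact fun r hr => (hΨderiv r (le_of_lt (mem_Ioi.1 hr))).differentiableAt.differentiableWithinAt
    refine monotoneOn_of_deriv_nonneg (convex_Ici L₁) hcont hdiff fun r hr => ?_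
    rw [interior_Ici] at hr
    have hr' : L₁ ≤ r := le_of_lt (mem_Ioi.1 hr)
    rw [(hΨderiv r hr').deriv]
    exact hΨ'ge r hr'
  -- ### (3) the boundary term at infinity: `Ψ(R) → 0`, hence `Ψ ≤ 0` on `[L₁, ∞)`
  have hκm : κ + m < 0 := by linarith
  have hκμ : κ + μ < 0 := by linarith
  have hlim1 : Tendsto (fun R : ℝ => C * R ^ (κ + m)) atTop (𝓝 0) := by
    have h := (tendsto_rpow_neg_atTop (y := -(κ + m)) (by linarith)).const_mul C
    simpa using h
  have hlim2 : Tendsto (fun R : ℝ => E * R ^ (κ + μ)) atTop (𝓝 0) := by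
    have h := (tendsto_rpow_neg_atTop (y := -(κ + μ)) (by linarith)).const_mul E
    simpa using h
  have hlimJ : Tendsto (fun R : ℝ => R ^ κ * J R) atTop (𝓝 0) := by
    refine squeeze_zero' ?_ ?_ hlim1
    · filter_upwards [eventually_ge_atTop L₁] with R hR
      exact mul_nonneg (Real.rpow_nonneg (hL₁0.le.trans hR) _) (hJ0 R (lt_of_lt_of_le hL₁0 hR))
    · filter_upwards [eventually_ge_atTop L₁] with R hR
      have hR0 : 0 < R := lt_of_lt_of_le hL₁0 hR
      calc R ^ κ * J R ≤ R ^ κ * (C * R ^ m) := mul_le_mul_of_nonneg_left (hbound R hR) (Real.rpow_nonneg hR0.le _)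
        _ = C * R ^ (κ + m) := by rw [Real.rpow_add hR0]; ring
  have hlimΨ : Tendsto Ψ atTop (𝓝 0) := by
    have h := hlimJ.sub hlim2
    rw [sub_zero] at h
    simpa only [hΨ] using h
  -- ### (4) the new power bound
  refine ⟨E, hE0, fun R hR => ?_⟩
  have hR0 : 0 < R := lt_of_lt_of_le hL₁0 hR
  have hΨle : Ψ R ≤ 0 :=
    ge_of_tendsto hlimΨ ((eventually_ge_atTop R).mono fun R' hR' =>
      hΨmono (mem_Ici.2 hR) (mem_Ici.2 (hR.trans hR')) hR')
  have hRκ0 : 0 < R ^ κ := Real.rpow_pos_of_pos hR0 _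
  have h1 : R ^ κ * J R ≤ E * R ^ (κ + μ) := by
    have := hΨle
    simp only [hΨ] at this
    linarith
  have h2 : R ^ κ * J R ≤ R ^ κ * (E * R ^ μ) := by
    calc R ^ κ * J R ≤ E * R ^ (κ + μ) := h1
      _ = R ^ κ * (E * R ^ μ) := by rw [Real.rpow_add hR0]; ring
  exact le_of_mul_le_mul_left h2 hRκ0

/-- **FINITELY MANY BOOTSTRAP STEPS REACH A NEGATIVE EXPONENT** at a negative rate (`c > 0`): from `J(R) ≤ C₀ R^{1−2ρ}` on `[1,∞)`, `C₀ ≤ 3c`,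
there are `m < 0`, `C ≥ 0`, `L₁ ≥ 1` with `J(R) ≤ C R^m` on `[L₁,∞)` (while `m ≥ 0` each step loses at least `5ρ/4`). [folklore] -/
theorem negRate_iterate (hρ : 0 < ρ) (hg : g < 0) (hc : 0 < (c : ℝ)) (hA0 : 0 ≤ A)
    (hJ0 : ∀ R : ℝ, 0 < R → 0 ≤ J R)
    (hflux : ∀ S : ℝ, 0 ≤ S → S ≤ 3 * c → ∀ L : ℝ, 1 ≤ L →
      (∀ R : ℝ, L ≤ R → J R ≤ R ^ (1 - 2 * ρ) * S) →
      ∀ r : ℝ, L ≤ r → |(2 + ρ) * r ^ (2 * ρ - 2) * F r| ≤ A * S ^ (1 / 2 : ℝ) * r ^ (-1 - (2 + ρ) / 4))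
    (hderiv : ∀ r : ℝ, 0 < r →
      HasDerivAt (fun L : ℝ => L ^ ((2 - 5 * g) / g) * J L) (g⁻¹ * r ^ ((2 - 5 * g) / g - 1) * F r) r)
    {C₀ : ℝ} (hC₀ : 0 ≤ C₀) (hC₀3 : C₀ ≤ 3 * c)
    (hbase : ∀ R : ℝ, 1 ≤ R → J R ≤ C₀ * R ^ (1 - 2 * ρ)) :
    ∃ m C L₁ : ℝ, m < 0 ∧ 0 ≤ C ∧ 1 ≤ L₁ ∧ ∀ R : ℝ, L₁ ≤ R → J R ≤ C * R ^ m := by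
  -- adapted from `slowRate_iterate` (…EnergySaturationSlowRate, ns-ezl-w6): the floor `max … (−κ/2)` is gone
  set d : ℝ := 5 * ρ / 4 with hd
  have hd0 : 0 < d := by rw [hd]; positivity
  have hQ : ∀ k : ℕ, ∃ m C L₁ : ℝ, 0 ≤ C ∧ 1 ≤ L₁ ∧ (∀ R : ℝ, L₁ ≤ R → J R ≤ C * R ^ m) ∧
      (m < 0 ∨ (m ≤ 1 - 2 * ρ - k * d ∧ m ≤ 1 - 2 * ρ ∧
        ∀ r : ℝ, L₁ ≤ r → C * r ^ (m - (1 - 2 * ρ)) ≤ 3 * c)) := by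
    intro k
    induction k with
    | zero =>
      refine ⟨1 - 2 * ρ, C₀, 1, hC₀, le_rfl, hbase, Or.inr ⟨by simp, le_rfl, fun r hr => ?_⟩⟩
      rw [sub_self, Real.rpow_zero, mul_one]
      exact hC₀3
    | succ k ih =>
      obtain ⟨m, C, L₁, hC, hL₁, hb, hcase⟩ := ih
      rcases hcase with hneg | ⟨hmk, hm, h3c⟩
      · exact ⟨m, C, L₁, hC, hL₁, hb, Or.inl hneg⟩
      by_cases hm0 : m < 0
      · exact ⟨m, C, L₁, hC, hL₁, hb, Or.inl hm0⟩
      push Not at hm0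
      obtain ⟨C', hC'0, hb'⟩ := negRate_step hρ hg hA0 hJ0 hflux hderiv hm hC hL₁ hb h3c
      set mp : ℝ := m / 2 - 5 * ρ / 4 with hmp
      by_cases hmp0 : mp < 0
      · exact ⟨mp, C', L₁, hC'0, hL₁, hb', Or.inl hmp0⟩
      push Not at hmp0
      have hmp_lt : mp < m := by rw [hmp]; nlinarith
      have hmp_k : mp ≤ 1 - 2 * ρ - (↑(k + 1) : ℝ) * d := by
        rw [hmp, hd]; push_cast; rw [hd] at hmk; nlinarith
      have hmp_le : mp ≤ 1 - 2 * ρ := by linarith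
      -- the exponent `mp − (1−2ρ) < 0`: enlarge the threshold so that the tail suprema are admissible
      have hexp : mp - (1 - 2 * ρ) < 0 := by linarith
      have htend : Tendsto (fun r : ℝ => C' * r ^ (mp - (1 - 2 * ρ))) atTop (𝓝 (C' * 0)) := by
        refine tendsto_const_nhds.mul ?_
        have := tendsto_rpow_neg_atTop (y := -(mp - (1 - 2 * ρ))) (by linarith)
        simpa using this
      rw [mul_zero] at htend
      have h3c0 : (0 : ℝ) < 3 * c := by positivity
      obtain ⟨L₂, hL₂δ, hL₂ge⟩ :=
        ((htend.eventually (gt_mem_nhds h3c0)).and (eventually_ge_atTop L₁)).exists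
      have hL₂1 : 1 ≤ L₂ := hL₁.trans hL₂ge
      have hL₂0 : 0 < L₂ := lt_of_lt_of_le one_pos hL₂1
      refine ⟨mp, C', L₂, hC'0, hL₂1, fun R hR => hb' R (hL₂ge.trans hR), Or.inr ⟨hmp_k, hmp_le, fun r hr => ?_⟩⟩
      have hr0 : 0 < r := lt_of_lt_of_le hL₂0 hr
      have hmono : r ^ (mp - (1 - 2 * ρ)) ≤ L₂ ^ (mp - (1 - 2 * ρ)) :=
        Real.rpow_le_rpow_of_nonpos hL₂0 hr hexp.le
      calc C' * r ^ (mp - (1 - 2 * ρ)) ≤ C' * L₂ ^ (mp - (1 - 2 * ρ)) := mul_le_mul_of_nonneg_left hmono hC'0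
        _ ≤ 3 * c := hL₂δ.le
  obtain ⟨k, hk⟩ := exists_nat_gt ((1 - 2 * ρ) / d)
  obtain ⟨m, C, L₁, hC, hL₁, hb, hcase⟩ := hQ k
  have hmneg : m < 0 := by
    rcases hcase with h | ⟨hmk, -, -⟩
    · exact h
    · have : (1 - 2 * ρ) < k * d := by rwa [div_lt_iff₀ hd0] at hk
      linarith
  exact ⟨m, C, L₁, hmneg, hC, hL₁, hb⟩

end Bootstrap

end EnergySaturation

end Summit.NavierStokesRegularity.NavierStokesRegularity.Theorems.PowerGaugeEulerLiouville

end
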